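import Literature.RepresentationTheory.KonnoKonno2007.JunctionPMinusWeilDatum
import Literature.RepresentationTheory.KonnoKonno2007.JunctionBallFrameBoost
import HarnessLib

/-!
# `𝔭⁻` on an archimedean Weil datum in the ball frame: the relation `D_v + i D_{iv} = 0` along `expP`
  [cite: Folland1989, Prop (4.39)]

REPRODUCTION (Literature side), sequel of `JunctionPMinusWeilDatum` through the boost dictionary of
`JunctionBallFrameBoost`.  Let `ω` be an archimedean Weil datum of the real unitary dual pair
`G_∞ = U(2,1) × U(R,S)` (`IsArchWeilDatum (ι𝕎 (Fin 2) Unit R S) ω`, the `U(2,1)` factor in the frame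
`UForm (Fin 2) Unit` of `RealUnitaryDualPairBallFrame`, identified with the ball model `U21` by `u21FrameEquiv`), and
let `expP b = exp [[0, b],[b^*, 0]]` (`b ∈ ℂ²`) be the exponential `𝔭`-chart of `UnitaryBallCauchyRiemann`.  For a
coordinate `p : Fin 2` put `v = -i e_p`.  Then

* §1 (group side) `t • v = (-i t) • e_p` and `t • (i v) = t • e_p` (`t : ℝ`), so that in `G_∞`
  `(u21FrameEquiv (expP (t • v)), 1) = (a_t, 1)` is theta-1's boost `hypV p () t` (`u21FrameEquiv_expP_negI`) and
  `(u21FrameEquiv (expP (t • (i v))), 1) = κ k_P(π/2) · (a_t, 1) · κ k_P(π/2)⁻¹` is the REAL boost, i.e. the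
  `k_P(π/2)`-conjugated boost of `JunctionPMinusWeilDatum` §0 (`coe_u21FrameEquiv_expP_real`,
  `coe_fst_κ_phaseP_conj_hypV_pi_div_two`);
* §2 (slopes) for EVERY `f ∈ 𝓢` the real difference quotients `t⁻¹ • (ω (u21FrameEquiv (expP (t • v)), 1) f − f)` and
  `t⁻¹ • (ω (u21FrameEquiv (expP (t • (i v))), 1) f − f)` converge in `𝓢` along `𝓝[≠] 0`, to `hypOpGen f` and to
  `rotBoostGen (π/2) f` [cite: Folland1989, (4.24)];
* §3 (the relation) whenever `hypOpGen f + i · rotBoostGen (π/2) f = 0` — for `S = ∅`: the vacuum `h_0`, every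
  degree-one vector `degOne a`, the rank-one family `degOneP b`, every `B⁻¹F` with `∂_{(p,r)}∂_{((),r)}F = 0` — the two
  limits `D`, `Dᵢ` satisfy `D + i Dᵢ = 0`: the lowest-weight / Cauchy–Riemann relation `(X_v + iX_{iv}) φ = 0`
  [cite: Folland1989, Prop (4.39)], stated in the EXISTENTIAL shape
  `∃ D Dᵢ, Tendsto … (𝓝 D) ∧ Tendsto … (𝓝 Dᵢ) ∧ D + i Dᵢ = 0` along the two real one-parameter families
  `t ↦ expP (t • v)`, `t ↦ expP (t • (i v))`, `v = -i e_p`, `p = 0, 1`.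
* §4 (transport) the same after any continuous `ℂ`-linear map `L : 𝓢 → 𝓢(E, ℂ)` into another Schwartz model (an
  intertwiner `A g (L f) = L (ω g f)` of a consumer's archimedean action): slopes `L (hypOpGen f)`, `L (rotBoostGen (π/2) f)` of
  `t ↦ L (ω (u21FrameEquiv (expP (t • v)), 1) f)`, relation `L D + i L Dᵢ = 0`, and the existential shape.

## Provenance

LEAN-IN-TREE rule (2026-08-18), pub-hodgecm formalisation cell, model-construction sub-cell, seat mc-theta-2
gen 7, node «W6b-hol (REP)» in the ball frame (the shape met by a consumer differentiating
`b ↦ ω (u21FrameEquiv (expP b), 1) Φ` at `0` along `-i e_p` and `e_p`).  Over `JunctionPMinusWeilDatum` (theta-2) and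
`JunctionBallFrameBoost` (pv08).  Kernel only, no records, no new hypotheses; nothing here is a claim of the manuscripts
adjudicated by that cell.
-/

set_option autoImplicit false

noncomputable section

open Matrix Complex MeasureTheory Filter MvPolynomial
open scoped Topology Real BigOperators ComplexConjugate
open Literature.Analysis.SegalBargmann Literature.Analysis.Distribution
open Literature.Geometry.ComplexHyperbolic Literature.Geometry.ComplexHyperbolic.BallModel
open Literature.AlgebraicGeometry.ShimuraVarieties Literature.AlgebraicGeometry.ShimuraVarieties.BallForms


namespace Literature.RepresentationTheory.KonnoKonno2007

namespace RealDualPair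

open Literature.NumberTheory.Weil1964 Literature.NumberTheory.Automorphic Literature.NumberTheory.Automorphic.UnitaryGroup

/-! ## §1  The two one-parameter families `expP (t • v)`, `expP (t • (i v))`, `v = -i e_p`, in `G_∞` -/

section Group

variable (R S : Type*) [Fintype R] [DecidableEq R] [Fintype S] [DecidableEq S]

/-- `t • (-i e_p) = (-i t) • e_p` and `t • (i (-i e_p)) = t • e_p` for a real time `t`. [folklore] -/
theorem smul_negI_single (p : Fin 2) (t : ℝ) :
    t • (-I • (Pi.single p 1 : Fin 2 → ℂ)) = (-I * (t : ℂ)) • (Pi.single p 1 : Fin 2 → ℂ) ∧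
      t • (I • (-I • (Pi.single p 1 : Fin 2 → ℂ))) = (t : ℂ) • (Pi.single p 1 : Fin 2 → ℂ) := by
  have hre : ∀ x : Fin 2 → ℂ, t • x = (t : ℂ) • x := fun x => (algebraMap_smul ℂ t x).symm
  refine ⟨?_, ?_⟩
  · rw [hre, smul_smul, mul_comm]
  · rw [smul_smul, show I * -I = 1 by simp, one_smul, hre]

/-- **direction `v = -i e_p`**: `(u21FrameEquiv (expP (t • v)), 1) = (a_t, 1)`, theta-1's boost `hypV p () t`.
[folklore] -/
theorem inl_u21FrameEquiv_expP_smul_negI (p : Fin 2) (t : ℝ) :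
    (((u21FrameEquiv (expP (t • (-I • (Pi.single p 1 : Fin 2 → ℂ)))) : UForm (Fin 2) Unit), (1 : UForm R S)) :
        Ginf (Fin 2) Unit R S) =
      (((hypV p () t : UForm (Fin 2) Unit), (1 : UForm R S)) : Ginf (Fin 2) Unit R S) := by
  rw [(smul_negI_single p t).1, u21FrameEquiv_expP_negI]

/-- **direction `i v = e_p`**: `(u21FrameEquiv (expP (t • (i v))), 1) = κ k_P(π/2) · (a_t, 1) · κ k_P(π/2)⁻¹`, the real
boost `plant [[cosh t, sinh t],[sinh t, cosh t]]`. [folklore] -/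
theorem inl_u21FrameEquiv_expP_smul_I_negI (p : Fin 2) (t : ℝ) :
    (((u21FrameEquiv (expP (t • (I • (-I • (Pi.single p 1 : Fin 2 → ℂ))))) : UForm (Fin 2) Unit), (1 : UForm R S)) :
        Ginf (Fin 2) Unit R S) =
      κ (Fin 2) Unit R S (phaseP R S p (π / 2)) * (((hypV p () t : UForm (Fin 2) Unit), (1 : UForm R S)) :
        Ginf (Fin 2) Unit R S) * κ (Fin 2) Unit R S (phaseP R S p (π / 2))⁻¹ := by
  rw [(smul_negI_single p t).2]
  refine Prod.ext ?_ ?_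
  · apply Subtype.ext
    apply Units.ext
    show (((u21FrameEquiv (expP ((t : ℂ) • (Pi.single p 1 : Fin 2 → ℂ))) : UForm (Fin 2) Unit) :
        GL (Fin 2 ⊕ Unit) ℂ) : Matrix (Fin 2 ⊕ Unit) (Fin 2 ⊕ Unit) ℂ) = _
    rw [coe_u21FrameEquiv_expP_real, coe_fst_κ_phaseP_conj_hypV_pi_div_two R S p () t]
  · exact (snd_κ_phaseP_conj_hypV R S p () (π / 2) t).symm

end Group

/-! ## §2  The slopes of `ω` along the two families -/

section Weil

variable {R S : Type*} [Fintype R] [DecidableEq R] [Fintype S] [DecidableEq S]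

/-- **slope along `expP (t • v)`, `v = -i e_p`**: `t⁻¹ • (ω (u21FrameEquiv (expP (t • v)), 1) f − f) ⟶ hypOpGen f` in `𝓢`.
[cite: Folland1989, (4.24)] -/
theorem weilDatum_tendsto_expP_smul_negI
    {ω : Representation ℂ (Ginf (Fin 2) Unit R S) (SchwartzMap (DPIdx (Fin 2) Unit R S → ℝ) ℂ)}
    (hW : IsArchWeilDatum (ι𝕎 (Fin 2) Unit R S) ω) (p : Fin 2) (f : SchwartzMap (DPIdx (Fin 2) Unit R S → ℝ) ℂ) :
    Tendsto (fun t : ℝ => t⁻¹ •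
        (ω (((u21FrameEquiv (expP (t • (-I • (Pi.single p 1 : Fin 2 → ℂ)))) : UForm (Fin 2) Unit), (1 : UForm R S)) :
          Ginf (Fin 2) Unit R S) f - f)) (𝓝[≠] 0) (𝓝 (hypOpGen R S p () f)) := by
  simp only [inl_u21FrameEquiv_expP_smul_negI]
  exact tendsto_ofReal_inv_smul_iff.1 (weilDatum_tendsto_hypV_sub_div_ofReal hW p () f)

/-- **slope along `expP (t • (i v))`, `v = -i e_p`**: `t⁻¹ • (ω (u21FrameEquiv (expP (t • (i v))), 1) f − f) ⟶ rotBoostGen (π/2) f`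
in `𝓢`. [cite: Folland1989, (4.24)] -/
theorem weilDatum_tendsto_expP_smul_I_negI
    {ω : Representation ℂ (Ginf (Fin 2) Unit R S) (SchwartzMap (DPIdx (Fin 2) Unit R S → ℝ) ℂ)}
    (hW : IsArchWeilDatum (ι𝕎 (Fin 2) Unit R S) ω) (p : Fin 2) (f : SchwartzMap (DPIdx (Fin 2) Unit R S → ℝ) ℂ) :
    Tendsto (fun t : ℝ => t⁻¹ •
        (ω (((u21FrameEquiv (expP (t • (I • (-I • (Pi.single p 1 : Fin 2 → ℂ))))) : UForm (Fin 2) Unit),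
          (1 : UForm R S)) : Ginf (Fin 2) Unit R S) f - f)) (𝓝[≠] 0) (𝓝 (rotBoostGen R S p () (π / 2) f)) := by
  simp only [inl_u21FrameEquiv_expP_smul_I_negI]
  exact tendsto_ofReal_inv_smul_iff.1 (weilDatum_tendsto_rotBoost_sub_div_ofReal R S p () hW (π / 2) f)

/-! ## §3  `D + i Dᵢ = 0` -/

/-- **THE RELATION `D_v + i D_{iv} = 0` ALONG `expP`, `v = -i e_p`, WITNESSES NAMED**: if
`hypOpGen f + i · rotBoostGen (π/2) f = 0` then `t⁻¹ • (ω (u21FrameEquiv (expP (t • v)), 1) f − f) ⟶ D := hypOpGen f`,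
`t⁻¹ • (ω (u21FrameEquiv (expP (t • (i v))), 1) f − f) ⟶ Dᵢ := rotBoostGen (π/2) f` (`t → 0`, `t ≠ 0`, in `𝓢`) and
`D + i Dᵢ = 0`. [cite: Folland1989, Prop (4.39); (4.24)] -/
theorem weilDatum_pMinus_expP_eq
    {ω : Representation ℂ (Ginf (Fin 2) Unit R S) (SchwartzMap (DPIdx (Fin 2) Unit R S → ℝ) ℂ)}
    (hW : IsArchWeilDatum (ι𝕎 (Fin 2) Unit R S) ω) (p : Fin 2) (f : SchwartzMap (DPIdx (Fin 2) Unit R S → ℝ) ℂ)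
    (hf : hypOpGen R S p () f + I • rotBoostGen R S p () (π / 2) f = 0) :
    Tendsto (fun t : ℝ => t⁻¹ •
        (ω (((u21FrameEquiv (expP (t • (-I • (Pi.single p 1 : Fin 2 → ℂ)))) : UForm (Fin 2) Unit),
          (1 : UForm R S)) : Ginf (Fin 2) Unit R S) f - f)) (𝓝[≠] 0) (𝓝 (hypOpGen R S p () f)) ∧
      Tendsto (fun t : ℝ => t⁻¹ •
        (ω (((u21FrameEquiv (expP (t • (I • (-I • (Pi.single p 1 : Fin 2 → ℂ))))) : UForm (Fin 2) Unit),
          (1 : UForm R S)) : Ginf (Fin 2) Unit R S) f - f)) (𝓝[≠] 0) (𝓝 (rotBoostGen R S p () (π / 2) f)) ∧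
      hypOpGen R S p () f + I • rotBoostGen R S p () (π / 2) f = 0 :=
  ⟨weilDatum_tendsto_expP_smul_negI hW p f, weilDatum_tendsto_expP_smul_I_negI hW p f, hf⟩

/-- the same in the EXISTENTIAL shape `∃ D Dᵢ, … ∧ … ∧ D + i Dᵢ = 0` (witnesses `D = hypOpGen f`, `Dᵢ = rotBoostGen (π/2) f`,
`weilDatum_pMinus_expP_eq`). [cite: Folland1989, Prop (4.39); (4.24)] -/
theorem weilDatum_pMinus_expP
    {ω : Representation ℂ (Ginf (Fin 2) Unit R S) (SchwartzMap (DPIdx (Fin 2) Unit R S → ℝ) ℂ)}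
    (hW : IsArchWeilDatum (ι𝕎 (Fin 2) Unit R S) ω) (p : Fin 2) (f : SchwartzMap (DPIdx (Fin 2) Unit R S → ℝ) ℂ)
    (hf : hypOpGen R S p () f + I • rotBoostGen R S p () (π / 2) f = 0) :
    ∃ D Dᵢ : SchwartzMap (DPIdx (Fin 2) Unit R S → ℝ) ℂ,
      Tendsto (fun t : ℝ => t⁻¹ •
          (ω (((u21FrameEquiv (expP (t • (-I • (Pi.single p 1 : Fin 2 → ℂ)))) : UForm (Fin 2) Unit),
            (1 : UForm R S)) : Ginf (Fin 2) Unit R S) f - f)) (𝓝[≠] 0) (𝓝 D) ∧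
        Tendsto (fun t : ℝ => t⁻¹ •
          (ω (((u21FrameEquiv (expP (t • (I • (-I • (Pi.single p 1 : Fin 2 → ℂ))))) : UForm (Fin 2) Unit),
            (1 : UForm R S)) : Ginf (Fin 2) Unit R S) f - f)) (𝓝[≠] 0) (𝓝 Dᵢ) ∧
        D + I • Dᵢ = 0 :=
  ⟨_, _, weilDatum_pMinus_expP_eq hW p f hf⟩

/-- the relation on every `B⁻¹F` with `∂_{(p,r)} ∂_{((),r)} F = 0` (`S = ∅`). [cite: Folland1989, Prop (4.39)] -/
theorem weilDatum_pMinus_expP_binvPi [IsEmpty S]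
    {ω : Representation ℂ (Ginf (Fin 2) Unit R S) (SchwartzMap (DPIdx (Fin 2) Unit R S → ℝ) ℂ)}
    (hW : IsArchWeilDatum (ι𝕎 (Fin 2) Unit R S) ω) (p : Fin 2) (F : MvPolynomial (DPIdx (Fin 2) Unit R S) ℂ)
    (hF : ∀ r : R, pderiv (Sum.inl (Sum.inl (p, r))) (pderiv (Sum.inr (Sum.inr ((), r))) F) = 0) :
    ∃ D Dᵢ : SchwartzMap (DPIdx (Fin 2) Unit R S → ℝ) ℂ,
      Tendsto (fun t : ℝ => t⁻¹ •
          (ω (((u21FrameEquiv (expP (t • (-I • (Pi.single p 1 : Fin 2 → ℂ)))) : UForm (Fin 2) Unit),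
            (1 : UForm R S)) : Ginf (Fin 2) Unit R S) (binvPi F) - binvPi F)) (𝓝[≠] 0) (𝓝 D) ∧
        Tendsto (fun t : ℝ => t⁻¹ •
          (ω (((u21FrameEquiv (expP (t • (I • (-I • (Pi.single p 1 : Fin 2 → ℂ))))) : UForm (Fin 2) Unit),
            (1 : UForm R S)) : Ginf (Fin 2) Unit R S) (binvPi F) - binvPi F)) (𝓝[≠] 0) (𝓝 Dᵢ) ∧
        D + I • Dᵢ = 0 :=
  weilDatum_pMinus_expP hW p _ (hypOpGen_add_I_smul_rotBoostGen_binvPi_eq_zero R S p () F hF)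

/-- **the relation on the vacuum** `h_0` (`S = ∅`). [cite: Folland1989, Prop (4.39)] -/
theorem weilDatum_pMinus_expP_hermitePi_zero [IsEmpty S]
    {ω : Representation ℂ (Ginf (Fin 2) Unit R S) (SchwartzMap (DPIdx (Fin 2) Unit R S → ℝ) ℂ)}
    (hW : IsArchWeilDatum (ι𝕎 (Fin 2) Unit R S) ω) (p : Fin 2) :
    ∃ D Dᵢ : SchwartzMap (DPIdx (Fin 2) Unit R S → ℝ) ℂ,
      Tendsto (fun t : ℝ => t⁻¹ •
          (ω (((u21FrameEquiv (expP (t • (-I • (Pi.single p 1 : Fin 2 → ℂ)))) : UForm (Fin 2) Unit),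
            (1 : UForm R S)) : Ginf (Fin 2) Unit R S) (hermitePi 0) - hermitePi 0)) (𝓝[≠] 0) (𝓝 D) ∧
        Tendsto (fun t : ℝ => t⁻¹ •
          (ω (((u21FrameEquiv (expP (t • (I • (-I • (Pi.single p 1 : Fin 2 → ℂ))))) : UForm (Fin 2) Unit),
            (1 : UForm R S)) : Ginf (Fin 2) Unit R S) (hermitePi 0) - hermitePi 0)) (𝓝[≠] 0) (𝓝 Dᵢ) ∧
        D + I • Dᵢ = 0 :=
  weilDatum_pMinus_expP hW p _ (hypOpGen_add_I_smul_rotBoostGen_hermitePi_zero R S p ())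

/-- **the relation on every degree-one vector** `degOne a = Σ a_i h_{e_i}` (`S = ∅`). [cite: Folland1989, Prop (4.39)] -/
theorem weilDatum_pMinus_expP_degOne [IsEmpty S]
    {ω : Representation ℂ (Ginf (Fin 2) Unit R S) (SchwartzMap (DPIdx (Fin 2) Unit R S → ℝ) ℂ)}
    (hW : IsArchWeilDatum (ι𝕎 (Fin 2) Unit R S) ω) (p : Fin 2) (a : DPIdx (Fin 2) Unit R S → ℂ) :
    ∃ D Dᵢ : SchwartzMap (DPIdx (Fin 2) Unit R S → ℝ) ℂ,
      Tendsto (fun t : ℝ => t⁻¹ •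
          (ω (((u21FrameEquiv (expP (t • (-I • (Pi.single p 1 : Fin 2 → ℂ)))) : UForm (Fin 2) Unit),
            (1 : UForm R S)) : Ginf (Fin 2) Unit R S) (degOne a) - degOne a)) (𝓝[≠] 0) (𝓝 D) ∧
        Tendsto (fun t : ℝ => t⁻¹ •
          (ω (((u21FrameEquiv (expP (t • (I • (-I • (Pi.single p 1 : Fin 2 → ℂ))))) : UForm (Fin 2) Unit),
            (1 : UForm R S)) : Ginf (Fin 2) Unit R S) (degOne a) - degOne a)) (𝓝[≠] 0) (𝓝 Dᵢ) ∧
        D + I • Dᵢ = 0 :=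
  weilDatum_pMinus_expP hW p _ (hypOpGen_add_I_smul_rotBoostGen_degOne R S p () a)

/-- **the relation on the rank-one degree-one family** `degOneP b = Σ_p b_p h_{e_{(p,⋆)}}` (`R = Unit`, `S = ∅`).
[cite: Folland1989, Prop (4.39)] -/
theorem weilDatum_pMinus_expP_degOneP [IsEmpty S]
    {ω : Representation ℂ (Ginf (Fin 2) Unit Unit S) (SchwartzMap (DPIdx (Fin 2) Unit Unit S → ℝ) ℂ)}
    (hW : IsArchWeilDatum (ι𝕎 (Fin 2) Unit Unit S) ω) (p : Fin 2) (b : Fin 2 → ℂ) :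
    ∃ D Dᵢ : SchwartzMap (DPIdx (Fin 2) Unit Unit S → ℝ) ℂ,
      Tendsto (fun t : ℝ => t⁻¹ •
          (ω (((u21FrameEquiv (expP (t • (-I • (Pi.single p 1 : Fin 2 → ℂ)))) : UForm (Fin 2) Unit),
            (1 : UForm Unit S)) : Ginf (Fin 2) Unit Unit S) (degOneP b) - degOneP b)) (𝓝[≠] 0) (𝓝 D) ∧
        Tendsto (fun t : ℝ => t⁻¹ •
          (ω (((u21FrameEquiv (expP (t • (I • (-I • (Pi.single p 1 : Fin 2 → ℂ))))) : UForm (Fin 2) Unit),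
            (1 : UForm Unit S)) : Ginf (Fin 2) Unit Unit S) (degOneP b) - degOneP b)) (𝓝[≠] 0) (𝓝 Dᵢ) ∧
        D + I • Dᵢ = 0 := by
  rw [degOneP_apply, degOnePR_apply]
  exact weilDatum_pMinus_expP_degOne hW p _

/-! ## §4  After a continuous linear transport of the Schwartz model

A consumer whose archimedean representation acts on another Schwartz model `𝓢(E, ℂ)` through an intertwining
continuous `ℂ`-linear map `L` (`A g (L f) = L (ω g f)`, e.g. a transport of coordinates or `f ↦ f ⊗ Ψ` into a completed
tensor product) meets the slopes of `t ↦ L (ω (u21FrameEquiv (expP (t • v)), 1) f)`; `L` commutes with the real difference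
quotients and with `D + i Dᵢ`. -/

/-- **THE RELATION AFTER A TRANSPORT `L : 𝓢 →L[ℂ] 𝓢(E, ℂ)`, WITNESSES NAMED**: the slopes of `t ↦ L (ω (expP (t • v), 1) f)` and
`t ↦ L (ω (expP (t • (i v)), 1) f)` at `0` are `L (hypOpGen f)`, `L (rotBoostGen (π/2) f)`, and
`L (hypOpGen f) + i L (rotBoostGen (π/2) f) = 0` whenever `hypOpGen f + i rotBoostGen (π/2) f = 0`. [cite: Folland1989, Prop (4.39); (4.24)] -/
theorem weilDatum_pMinus_expP_map_eq {E : Type*} [NormedAddCommGroup E] [NormedSpace ℝ E]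
    {ω : Representation ℂ (Ginf (Fin 2) Unit R S) (SchwartzMap (DPIdx (Fin 2) Unit R S → ℝ) ℂ)}
    (hW : IsArchWeilDatum (ι𝕎 (Fin 2) Unit R S) ω) (p : Fin 2) (f : SchwartzMap (DPIdx (Fin 2) Unit R S → ℝ) ℂ)
    (hf : hypOpGen R S p () f + I • rotBoostGen R S p () (π / 2) f = 0)
    (L : SchwartzMap (DPIdx (Fin 2) Unit R S → ℝ) ℂ →L[ℂ] SchwartzMap E ℂ) :
    Tendsto (fun t : ℝ => t⁻¹ •
        (L (ω (((u21FrameEquiv (expP (t • (-I • (Pi.single p 1 : Fin 2 → ℂ)))) : UForm (Fin 2) Unit),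
          (1 : UForm R S)) : Ginf (Fin 2) Unit R S) f) - L f)) (𝓝[≠] 0) (𝓝 (L (hypOpGen R S p () f))) ∧
      Tendsto (fun t : ℝ => t⁻¹ •
        (L (ω (((u21FrameEquiv (expP (t • (I • (-I • (Pi.single p 1 : Fin 2 → ℂ))))) : UForm (Fin 2) Unit),
          (1 : UForm R S)) : Ginf (Fin 2) Unit R S) f) - L f)) (𝓝[≠] 0) (𝓝 (L (rotBoostGen R S p () (π / 2) f))) ∧
      L (hypOpGen R S p () f) + I • L (rotBoostGen R S p () (π / 2) f) = 0 := by
  obtain ⟨h₁, h₂, h₃⟩ := weilDatum_pMinus_expP_eq hW p f hf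
  have key : ∀ (u : ℝ → SchwartzMap (DPIdx (Fin 2) Unit R S → ℝ) ℂ) (y : SchwartzMap (DPIdx (Fin 2) Unit R S → ℝ) ℂ),
      Tendsto (fun t : ℝ => t⁻¹ • (u t - f)) (𝓝[≠] 0) (𝓝 y) →
        Tendsto (fun t : ℝ => t⁻¹ • (L (u t) - L f)) (𝓝[≠] 0) (𝓝 (L y)) := fun u y h => by
    have h' := (L.continuous.tendsto y).comp h
    refine h'.congr fun t => ?_
    simp only [Function.comp_apply, ContinuousLinearMap.map_smul_of_tower, map_sub]
  refine ⟨key _ _ h₁, key _ _ h₂, ?_⟩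
  rw [← ContinuousLinearMap.map_smul, ← map_add, h₃, map_zero]

/-- **the relation after a transport, EXISTENTIAL shape**: `∃ D Dᵢ, … ∧ … ∧ D + i Dᵢ = 0` for the family
`t ↦ L (ω (u21FrameEquiv (expP (t • v)), 1) f)`, `v = -i e_p` (instances of `hf`: `hypOpGen_add_I_smul_rotBoostGen_hermitePi_zero`,
`hypOpGen_add_I_smul_rotBoostGen_degOne`, `hypOpGen_add_I_smul_rotBoostGen_binvPi_eq_zero`, all for `S = ∅`).
[cite: Folland1989, Prop (4.39); (4.24)] -/
theorem weilDatum_pMinus_expP_map {E : Type*} [NormedAddCommGroup E] [NormedSpace ℝ E]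
    {ω : Representation ℂ (Ginf (Fin 2) Unit R S) (SchwartzMap (DPIdx (Fin 2) Unit R S → ℝ) ℂ)}
    (hW : IsArchWeilDatum (ι𝕎 (Fin 2) Unit R S) ω) (p : Fin 2) (f : SchwartzMap (DPIdx (Fin 2) Unit R S → ℝ) ℂ)
    (hf : hypOpGen R S p () f + I • rotBoostGen R S p () (π / 2) f = 0)
    (L : SchwartzMap (DPIdx (Fin 2) Unit R S → ℝ) ℂ →L[ℂ] SchwartzMap E ℂ) :
    ∃ D Dᵢ : SchwartzMap E ℂ,
      Tendsto (fun t : ℝ => t⁻¹ •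
          (L (ω (((u21FrameEquiv (expP (t • (-I • (Pi.single p 1 : Fin 2 → ℂ)))) : UForm (Fin 2) Unit),
            (1 : UForm R S)) : Ginf (Fin 2) Unit R S) f) - L f)) (𝓝[≠] 0) (𝓝 D) ∧
        Tendsto (fun t : ℝ => t⁻¹ •
          (L (ω (((u21FrameEquiv (expP (t • (I • (-I • (Pi.single p 1 : Fin 2 → ℂ))))) : UForm (Fin 2) Unit),
            (1 : UForm R S)) : Ginf (Fin 2) Unit R S) f) - L f)) (𝓝[≠] 0) (𝓝 Dᵢ) ∧
        D + I • Dᵢ = 0 :=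
  ⟨_, _, weilDatum_pMinus_expP_map_eq hW p f hf L⟩

end Weil

end RealDualPair

end Literature.RepresentationTheory.KonnoKonno2007

end
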